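import Mathlib
import Summits.ResolutionOfSingularities.ResolutionOfSingularities.Theorems.RadicialJungCleanModelsGenerisation
import Literature.AlgebraicGeometry.Resolution.LocalBlowup
import Literature.AlgebraicGeometry.Resolution.RegularLocalRingsProofs
import HarnessLib

/-!
# Crux stmt-ResolutionOfSingularities-15917 (`RadicialJung.CleanModels`), skeleton `Sketch` rev 13, stub `stub_cleanPatching3`:
# clean-regular data GENERISE from the centre of a refined valuation ring to the centre of the original one

Plan card `Cruxes/CleanModels/Lines/Sketch-P2-plan.md` (lead `res-B-lead-1` g0, 2026-08-28).  After refining a valuation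
ring `O` to `O' ≤ O` with a closed centre (`RadicialJungCleanModelsValuationRefinement.lean`, p659805) and obtaining a model
`B ⊆ O'` whose local ring `S' = B_{𝔪_{O'} ∩ B}` at the centre of `O'` is regular with `x ∈ K` loosely clean there, one must
come back to `O`: the local ring `S = B_{𝔪_O ∩ B}` at the centre of `O` is the localisation of `S'` at the prime
`𝔪_O ∩ S'` (a generisation), so

* `locAtCentre_locAtCentre_of_le` — `(B_{𝔪_{O'} ∩ B})_{𝔪_O ∩ ·} = B_{𝔪_O ∩ B}` inside `K`, for `O' ≤ O`, `B ⊆ O'`;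
* `looseClean_generises_of_le` — `S` is regular (localisation of a regular local ring, `isRegularLocalRing_localization_atPrime`)
  and some TWIST `e^p x^α - d^p` (`e ≠ 0`, `p ∤ α`) of `x` is loosely clean at `S` — the line's generisation lemma
  `stub_looseGenerises` (`RadicialJungCleanModelsGenerisation.lean`) applied through `isLocalization_locAtCentre`.

Pure algebra on top of landed files; nothing here proves resolution in characteristic `p`.
-/

noncomputable section

set_option linter.dupNamespace false

open IsLocalRing
open Literature.AlgebraicGeometry.Resolution

namespace Summit.ResolutionOfSingularities.ResolutionOfSingularities.Theorems.RadicialJung.CleanModels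

/-- Units pass up along `O' ≤ O`: an element of value `1` for `O'` has value `1` for `O`. [folklore] -/
theorem valuation_eq_one_of_le {K : Type*} [Field K] {O O' : ValuationSubring K} (hle : O' ≤ O) {z : K}
    (hz : O'.valuation z = 1) : O.valuation z = 1 := by
  have hzO' : z ∈ O' := (O'.valuation_le_one_iff z).mp hz.le
  have hz0 : z ≠ 0 := ne_zero_of_valuation_eq_one hz
  have hinv : z⁻¹ ∈ O' := (O'.valuation_le_one_iff _).mp (by rw [map_inv₀, hz, inv_one])
  apply le_antisymm (O.valuation_le_one ⟨z, hle hzO'⟩)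
  have h1 : O.valuation z⁻¹ ≤ 1 := (O.valuation_le_one_iff _).mpr (hle hinv)
  rw [map_inv₀] at h1
  have hvz0 : O.valuation z ≠ 0 := by
    intro h; exact hz0 ((Valuation.zero_iff _).mp h)
  calc (1 : _) = (O.valuation z)⁻¹ * O.valuation z := (inv_mul_cancel₀ hvz0).symm
    _ ≤ 1 * O.valuation z := mul_le_mul_left h1 _
    _ = O.valuation z := one_mul _

/-- **Localising at the centre of a coarser valuation ring**: for valuation subrings `O' ≤ O` of `K` and a subring `B ⊆ O'`,
`(B_{𝔪_{O'} ∩ B})_{𝔪_O ∩ ·} = B_{𝔪_O ∩ B}` inside `K`. [folklore] -/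
theorem locAtCentre_locAtCentre_of_le {K : Type*} [Field K] {O O' : ValuationSubring K} (hle : O' ≤ O)
    (B : Subring K) : locAtCentre (locAtCentre B O') O = locAtCentre B O := by
  apply le_antisymm
  · rintro x ⟨y, hy, z, hz, hvz, rfl⟩
    obtain ⟨b₁, hb₁, s₁, hs₁, hvs₁, rfl⟩ := (mem_locAtCentre_iff).mp hy
    obtain ⟨b₂, hb₂, s₂, hs₂, hvs₂, rfl⟩ := (mem_locAtCentre_iff).mp hz
    have hs₁O : O.valuation s₁ = 1 := valuation_eq_one_of_le hle hvs₁
    have hs₂O : O.valuation s₂ = 1 := valuation_eq_one_of_le hle hvs₂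
    have hs₁0 : s₁ ≠ 0 := ne_zero_of_valuation_eq_one hvs₁
    have hs₂0 : s₂ ≠ 0 := ne_zero_of_valuation_eq_one hvs₂
    have hb₂O : O.valuation b₂ = 1 := by
      rw [map_div₀, hs₂O, div_one] at hvz
      exact hvz
    refine (mem_locAtCentre_iff).mpr ⟨b₁ * s₂, B.mul_mem hb₁ hs₂, s₁ * b₂, B.mul_mem hs₁ hb₂, ?_, ?_⟩
    · rw [map_mul, hs₁O, hb₂O, one_mul]
    · have hb₂0 : b₂ ≠ 0 := ne_zero_of_valuation_eq_one hb₂O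
      field_simp
  · exact locAtCentre_mono O (le_locAtCentre B O')

/-- **Loose cleanness and regularity generise from a refined centre.**  Let `O' ≤ O` be valuation subrings of a field `K` of
characteristic `p`, `B ⊆ O'` a subring whose local ring `S' = B_{𝔪_{O'} ∩ B}` is regular with fraction field `K`, and `x ∈ K`
loosely clean at `S'`.  Then `S = B_{𝔪_O ∩ B}` is regular and some twist `e^p x^α - d^p` (`e ≠ 0`, `α` prime to `p`) is loosely
clean at `S`. [folklore] -/
theorem looseClean_generises_of_le {K : Type} [Field K] (p : ℕ) [Fact p.Prime] [CharP K p]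
    {O O' : ValuationSubring K} (hle : O' ≤ O) (B : Subring K) (hB : B ≤ O'.toSubring)
    (hreg : IsRegularLocalRing (locAtCentre B O')) (hfrac : IsFractionRing (locAtCentre B O') K) (x : K)
    (hx : (∃ (d m : ℕ) (hmd : m ≤ d) (t : Fin d → locAtCentre B O') (a : Fin m → ℕ) (u : locAtCentre B O'),
          IsUnit u ∧ Ideal.span (Set.range t) = maximalIdeal (locAtCentre B O') ∧
          ringKrullDim (locAtCentre B O') = (d : WithBot ℕ∞) ∧ 0 < m ∧ (∀ i, ¬ p ∣ a i) ∧
          x = (u : K) * ∏ i : Fin m, ((t (Fin.castLE hmd i) : locAtCentre B O') : K) ^ (a i)) ∨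
        (∃ u : locAtCentre B O', IsUnit u ∧ x = (u : K) ∧
          ∀ c : locAtCentre B O', u - c ^ p ∉ maximalIdeal (locAtCentre B O')) ∨
        (∃ s c : locAtCentre B O', x = (s : K) ∧ s - c ^ p ∈ maximalIdeal (locAtCentre B O') ∧
          s - c ^ p ∉ maximalIdeal (locAtCentre B O') ^ 2)) :
    ∃ (_ : IsRegularLocalRing (locAtCentre B O)) (α : ℕ) (e d : K), α.Coprime p ∧ e ≠ 0 ∧
      ((∃ (d' m : ℕ) (hmd : m ≤ d') (t : Fin d' → locAtCentre B O) (a : Fin m → ℕ) (u : locAtCentre B O),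
          IsUnit u ∧ Ideal.span (Set.range t) = maximalIdeal (locAtCentre B O) ∧
          ringKrullDim (locAtCentre B O) = (d' : WithBot ℕ∞) ∧ 0 < m ∧ (∀ i, ¬ p ∣ a i) ∧
          e ^ p * x ^ α - d ^ p = (u : K) * ∏ i : Fin m, ((t (Fin.castLE hmd i) : locAtCentre B O) : K) ^ (a i)) ∨
        (∃ u : locAtCentre B O, IsUnit u ∧ e ^ p * x ^ α - d ^ p = (u : K) ∧
          ∀ c' : locAtCentre B O, u - c' ^ p ∉ maximalIdeal (locAtCentre B O)) ∨
        (∃ s c' : locAtCentre B O, e ^ p * x ^ α - d ^ p = (s : K) ∧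
          s - c' ^ p ∈ maximalIdeal (locAtCentre B O) ∧ s - c' ^ p ∉ maximalIdeal (locAtCentre B O) ^ 2)) := by
  classical
  haveI := hreg
  haveI := hfrac
  set S' : Subring K := locAtCentre B O' with hS'def
  have hS'O' : S' ≤ O'.toSubring := locAtCentre_le hB
  have hS'O : S' ≤ O.toSubring := fun y hy => hle (hS'O' hy)
  haveI : CharP S' p := (S'.subtype).charP Subtype.val_injective p
  -- the local ring at the centre of `O` is the localisation of `S'` at its centre prime
  have hSS : locAtCentre S' O = locAtCentre B O := locAtCentre_locAtCentre_of_le hle B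
  haveI := isLocalization_locAtCentre (K := K) (O := O) hS'O
  haveI : IsLocalRing (locAtCentre S' O) := isLocalRing_locAtCentre hS'O
  -- regularity generises
  have hregS : IsRegularLocalRing (locAtCentre S' O) :=
    (isRegularLocalRing_locAtCentre_iff hS'O).mpr (isRegularLocalRing_localization_atPrime S' _)
  -- loose cleanness generises (the line's lemma), in the `algebraMap` format
  have hx' : (∃ (d m : ℕ) (hmd : m ≤ d) (t : Fin d → S') (a : Fin m → ℕ) (u : S'), IsUnit u ∧
        Ideal.span (Set.range t) = maximalIdeal S' ∧ ringKrullDim S' = (d : WithBot ℕ∞) ∧ 0 < m ∧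
        (∀ i, ¬ p ∣ a i) ∧ x = algebraMap S' K (u * ∏ i : Fin m, t (Fin.castLE hmd i) ^ (a i))) ∨
      (∃ u : S', IsUnit u ∧ x = algebraMap S' K u ∧ ∀ c : S', u - c ^ p ∉ maximalIdeal S') ∨
      (∃ s c : S', x = algebraMap S' K s ∧ s - c ^ p ∈ maximalIdeal S' ∧ s - c ^ p ∉ maximalIdeal S' ^ 2) := by
    rcases hx with ⟨d, m, hmd, t, a, u, hu, ht, hd, hm, ha, hxeq⟩ | ⟨u, hu, hxeq, hc⟩ | ⟨s, c, hxeq, h1, h2⟩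
    · refine Or.inl ⟨d, m, hmd, t, a, u, hu, ht, hd, hm, ha, ?_⟩
      rw [hxeq]
      change _ = ((u * ∏ i : Fin m, t (Fin.castLE hmd i) ^ (a i) : S') : K)
      push_cast
      rfl
    · exact Or.inr (Or.inl ⟨u, hu, hxeq, hc⟩)
    · exact Or.inr (Or.inr ⟨s, c, hxeq, h1, h2⟩)
  obtain ⟨α, e, d, hα, he, hgen⟩ := stub_looseGenerises (O := S') p (K := K)
    (subringCentre S' O hS'O) (locAtCentre S' O) x hx'
  rw [← hSS]
  refine ⟨hregS, α, e, d, hα, he, ?_⟩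
  rcases hgen with ⟨d', m, hmd, t, a, u, hu, ht, hd, hm, ha, heq⟩ | ⟨u, hu, heq, hc⟩ | ⟨s, c', heq, h1, h2⟩
  · refine Or.inl ⟨d', m, hmd, t, a, u, hu, ht, hd, hm, ha, ?_⟩
    rw [heq]
    change ((u * ∏ i : Fin m, t (Fin.castLE hmd i) ^ (a i) : locAtCentre S' O) : K) = _
    push_cast
    rfl
  · exact Or.inr (Or.inl ⟨u, hu, heq, hc⟩)
  · exact Or.inr (Or.inr ⟨s, c', heq, h1, h2⟩)

end Summit.ResolutionOfSingularities.ResolutionOfSingularities.Theorems.RadicialJung.CleanModels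

end
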